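import Summits.HodgeConjecture.HodgeConjecture.Theses.PadicSemiregularLift
import Literature.AlgebraicGeometry.Motives.AbelianVarietyProjectiveChart
import Literature.AlgebraicGeometry.Motives.AbelianVarietyDimZeroProofs
import Literature.AlgebraicGeometry.Motives.VarietiesUnitProofs
import Literature.AlgebraicGeometry.Motives.VarietiesGeometricallyIntegralProofs
import Literature.AlgebraicGeometry.Motives.VarietiesDimensionProofs
import Literature.AlgebraicGeometry.Motives.ComplexPointsManifold
import Literature.AlgebraicTopology.SingularHomology.CohomologyOfPoint
import Literature.AlgebraicGeometry.HodgeTheory.HodgeModelExistence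
import Literature.AlgebraicGeometry.HodgeTheory.LefschetzOneOne
import Literature.AlgebraicGeometry.HodgeTheory.HardLefschetzNFold
import Literature.AlgebraicGeometry.HodgeTheory.TopDegreeClasses
import Literature.AlgebraicGeometry.HodgeTheory.WeilClassesFourfolds

/-!
# `HodgeAbelianVarieties` (stmt-HodgeConjecture-1333) · Negative · where a counterexample must live

Negative-side knowledge for the crux `PadicSemiregularLift.HodgeAbelianVarieties`
(`∀ A : AbelianVariety ℂ, HodgeConjectureFor A.dim A.X`, the Hodge conjecture for complex abelian
varieties), all unconditional Lean theorems (conditional ones take the tree named facts as explicit hypotheses), extracted from the standing disprover's work file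
`Cruxes/HodgeAbelianVarieties/Disproof.lean` (refuter-cdisprove-stmt-HodgeConjecture-1333-0, cycle 1,
2026-08-15) so that ideators, planners and provers can import them:

* `iff_hodgeConjecture_restricted`, `not_hodgeConjecture_of_not`: the crux is the summit restricted to
  abelian varieties (smooth-projectivity of `A.X` is PROVED in the tree), so any kill kills
  `HodgeConjecture` — the crux is not a stronger statement than HC;
* `exists_abelianVariety_dim_eq_zero`, `hodgeConjectureFor_iff_nonempty_hodgeModel_of_dim_eq_zero`:
  the binder is inhabited and at its degenerate end (`dim A = 0`) the crux is exactly the anti-vacuity conjunct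
  `Nonempty (HodgeModel 0 _)`, discharged by the named fact `nonempty_hodgeModel`;
* `mem_algebraicClasses_of_dim_le`, `hodgeAbelianVarieties_iff_middle`: unconditionally the extreme
  codimensions `p = 0`, `p ≥ dim A` are harmless, so the crux is its part `1 ≤ p < dim A`;
* `hodgeAbelianVarieties_iff_deepMiddle`: granting the tree's named facts Lefschetz `(1,1)` and hard
  Lefschetz, the crux is its part `2 ≤ p`, `2p ≤ dim A` — a minimal counterexample has `dim A ≥ 4`
  (in print `≥ 6`: Markman, arXiv:2509.23403 Cor. 1.3);
* `of_dim_le_three`, `weilPlane_dim_four`: the settled instances reachable from tree facts.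
-/

noncomputable section

open CategoryTheory CategoryTheory.Limits AlgebraicGeometry MonoidalCategory

namespace Summit.HodgeConjecture.HodgeConjecture.Theorems.HodgeAbelianVarieties.Negative

open Summit.HodgeConjecture.HodgeConjecture.Theses.PadicSemiregularLift
open Literature.AlgebraicGeometry Literature.AlgebraicGeometry.HodgeTheory
  Literature.AlgebraicGeometry.Motives Literature.AlgebraicTopology.SingularHomology

/-! ## Read-back and the upper bound: the crux is the summit restricted to abelian varieties -/

/-- READ-BACK of the crux, symbol by symbol: for every bundled complex abelian variety `A`, (i) a
Hodge model of `A.X` in dimension `A.dim` exists and (ii) every rational class of Hodge type `(p,p)`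
in `H²ᵖ(A(ℂ); ℂ)` lies in `algebraicClasses A.X p = Nᵖ H²ᵖ`. Definitional (`Iff.rfl`). [folklore] -/
theorem hodgeAbelianVarieties_iff :
    HodgeAbelianVarieties ↔
      ∀ A : AbelianVariety ℂ, Nonempty (HodgeModel A.dim A.X) ∧
        ∀ (p : ℕ) (c : singularCohomology ℂ ℂ (ComplexPoints A.X) (2 * p)),
          IsRationalClass c → IsOfHodgeType A.dim A.X (2 * p) p p c → c ∈ algebraicClasses A.X p :=
  Iff.rfl

/-- **The crux is the summit restricted to abelian varieties**. Every bundled abelian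
variety is a smooth projective geometrically irreducible variety of dimension `A.dim`
(`AbelianVariety.isSmoothProjective_holds`, PROVED in the tree: Görtz–Wedhorn Thm. 27.71 /
Prop. 27.174), so the smooth-projectivity guard of the summit is automatic on the binder. Consequently
the crux carries no statement STRONGER than the Hodge conjecture (`HodgeConjecture` gives the right-hand
side by `fun A _ ↦ h _`): it cannot be false unless HC is. [folklore] -/
theorem iff_hodgeConjecture_restricted :
    HodgeAbelianVarieties ↔
      ∀ A : AbelianVariety ℂ, IsSmoothProjective A.dim A.X → HodgeConjectureFor A.dim A.X :=
  ⟨fun h A _ ↦ h A, fun h A ↦ h A (AbelianVariety.isSmoothProjective_holds (A := A))⟩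

/-- **Any kill of the crux kills the summit** (route kill criterion (c), now formal): a
counterexample to `HodgeAbelianVarieties` is a counterexample to `HodgeConjecture`. [folklore] -/
theorem not_hodgeConjecture_of_not (h : ¬ HodgeAbelianVarieties) : ¬ _root_.HodgeConjecture :=
  fun hc ↦ h (iff_hodgeConjecture_restricted.2 fun _ hA ↦ hc hA)

/-- With the named fact `nonempty_hodgeModel` (Serre GAGA + de Rham + Hodge decomposition; D-0014)
the anti-vacuity conjunct is discharged on every abelian variety, so the crux is exactly its CYCLE
part. [cite: Deligne2000, §1] -/
theorem iff_cyclePart (hM : ∀ (n : ℕ) (X : SchemeOver ℂ), nonempty_hodgeModel n X) :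
    HodgeAbelianVarieties ↔
      ∀ (A : AbelianVariety ℂ) (p : ℕ) (c : singularCohomology ℂ ℂ (ComplexPoints A.X) (2 * p)),
        IsRationalClass c → IsOfHodgeType A.dim A.X (2 * p) p p c → c ∈ algebraicClasses A.X p :=
  ⟨fun h A ↦ (h A).2,
    fun h A ↦ ⟨hM _ _ (AbelianVariety.isSmoothProjective_holds (A := A)), h A⟩⟩

/-! ## Non-vacuity of the binder and the degenerate instance `dim A = 0` -/

/-- **The binder is inhabited, already in dimension `0`**: the zero abelian variety `Spec ℂ → Spec ℂ`
with the trivial group law (the monoidal unit of `SchemeOver ℂ` with Mathlib's `GrpObj.instTensorUnit`;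
proper as an identity, geometrically integral and of `schemeDim = 0` by the tree's PROVED facts about
the smooth projective `0`-fold `Spec ℂ`). So `HodgeAbelianVarieties` is not vacuously true, and its
degenerate end is reached. (The named construction is `zeroAbelianVariety` in the crux work file
`Cruxes/HodgeAbelianVarieties/Disproof.lean`.) [folklore] -/
theorem exists_abelianVariety_dim_eq_zero : ∃ A : AbelianVariety ℂ, A.dim = 0 :=
  ⟨{ X := 𝟙_ (SchemeOver ℂ)
     grpObj := GrpObj.instTensorUnit
     isProper := inferInstanceAs (IsProper (𝟙 (Spec (.of ℂ))))
     geometricallyIntegral :=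
       IsSmoothProjective.geometricallyIntegral_holds (isSmoothProjective_unit_holds ℂ) },
    schemeDim_eq_holds (isSmoothProjective_unit_holds ℂ)⟩

/-- An abelian variety of dimension `0` has exactly one complex point: its structure morphism is an
isomorphism (`AbelianVariety.isIso_hom_of_dim_eq_zero`, PROVED in the tree), so sections of it over
`Spec ℂ` coincide. [folklore] -/
theorem subsingleton_complexPoints_of_dim_eq_zero (A : AbelianVariety ℂ) (h : A.dim = 0) :
    Subsingleton (ComplexPoints A.X) := by
  haveI := A.isIso_hom_of_dim_eq_zero h
  refine ⟨fun P Q ↦ ?_⟩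
  apply Over.OverMorphism.ext
  rw [← cancel_mono A.X.hom, Over.w, Over.w]

/-- **Degenerate instance.** On an abelian variety of dimension `0` the crux is EXACTLY
the anti-vacuity conjunct: the cycle part holds because `algebraicClasses _ 0 = ⊤` (`p = 0`) and
`H²ᵖ(pt; ℂ) = 0` for `p ≥ 1` (Hatcher §3.1; the tree's PROVED
`isZero_singularCohomology_of_subsingleton'`). So the junk end of the binder neither refutes nor
trivialises the crux: it asks for a Hodge model of the point, a theorem in print.
[cite: HatcherAT2002, §3.1 p. 199] -/
theorem hodgeConjectureFor_iff_nonempty_hodgeModel_of_dim_eq_zero (A : AbelianVariety ℂ)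
    (h : A.dim = 0) : HodgeConjectureFor A.dim A.X ↔ Nonempty (HodgeModel A.dim A.X) := by
  refine ⟨fun h' ↦ h'.1, fun hM ↦ ⟨hM, fun p c _ _ ↦ ?_⟩⟩
  rcases Nat.eq_zero_or_pos p with rfl | hp
  · exact hodgeConjectureFor_codim_zero c
  · haveI := subsingleton_complexPoints_of_dim_eq_zero A h
    have hz : IsZero (singularCohomology ℂ ℂ (ComplexPoints A.X) (2 * p)) :=
      singularCochainComplex.isZero_singularCohomology_of_subsingleton' (by omega)
    haveI := ModuleCat.subsingleton_of_isZero hz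
    rw [Subsingleton.elim c 0]
    exact Submodule.zero_mem _

/-- **The crux in dimension `0`, discharged from the named fact `nonempty_hodgeModel`** (every
abelian variety is smooth projective of dimension `A.dim`, PROVED in the tree, so the fact applies).
[cite: SerreGAGA1956, §2] -/
theorem hodgeConjectureFor_of_dim_eq_zero (A : AbelianVariety ℂ) (h : A.dim = 0)
    (hM : nonempty_hodgeModel A.dim A.X) : HodgeConjectureFor A.dim A.X :=
  (hodgeConjectureFor_iff_nonempty_hodgeModel_of_dim_eq_zero A h).2
    (hM (AbelianVariety.isSmoothProjective_holds (A := A)))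

/-! ## Where a counterexample must live: extreme codimensions are harmless -/

/-- **Extreme codimensions (no Hodge-type or rationality hypothesis).** On an abelian
variety `A`, every class of `H²ᵖ(A(ℂ); ℂ)` with `p = 0` or `A.dim ≤ p` is algebraic: `p = 0` is
`algebraicClasses_zero`; `p = dim A ≥ 1` is the top degree (`mem_algebraicClasses_of_degree_top`:
every class vanishes off a closed point); `p > dim A` is the zero group
(`subsingleton_singularCohomology_of_lt`, Hatcher Thm. 3.26(c) on the closed `2n`-manifold `A(ℂ)`);
`dim A = 0 < p` is `H²ᵖ(pt) = 0`. [cite: HatcherAT2002, §3.3 Thm. 3.26(c)]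
[cite: VoisinHodgeII2003, §10.2.3 proof of Prop. 10.26] -/
theorem mem_algebraicClasses_of_dim_le (A : AbelianVariety ℂ) {p : ℕ} (hp : p = 0 ∨ A.dim ≤ p)
    (c : singularCohomology ℂ ℂ (ComplexPoints A.X) (2 * p)) : c ∈ algebraicClasses A.X p := by
  have hX : IsSmoothProjective A.dim A.X := AbelianVariety.isSmoothProjective_holds
  rcases Nat.eq_zero_or_pos p with rfl | hp0
  · exact hodgeConjectureFor_codim_zero c
  have hdp : A.dim ≤ p := hp.resolve_left (by omega)
  rcases hdp.eq_or_lt with hdp' | hdp'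
  · -- top degree `p = dim A ≥ 1`
    subst hdp'
    exact mem_algebraicClasses_of_degree_top hX hp0 c
  · -- above the top degree the group vanishes
    haveI := ComplexPoints.subsingleton_singularCohomology_of_lt hX ℂ (k := 2 * p) (by omega)
    rw [Subsingleton.elim c 0]
    exact Submodule.zero_mem _

/-- **The crux is equivalent to its middle-codimension part** `1 ≤ p < dim A` (plus the anti-vacuity
conjunct). A counterexample, if any, is a rational `(p,p)`-class with `1 ≤ p ≤ dim A - 1`.
[cite: VoisinHodgeII2003, §10.2.3 proof of Prop. 10.26] -/
theorem hodgeAbelianVarieties_iff_middle :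
    HodgeAbelianVarieties ↔
      ∀ A : AbelianVariety ℂ, Nonempty (HodgeModel A.dim A.X) ∧
        ∀ p : ℕ, 1 ≤ p → p < A.dim →
          ∀ c : singularCohomology ℂ ℂ (ComplexPoints A.X) (2 * p), IsRationalClass c →
            IsOfHodgeType A.dim A.X (2 * p) p p c → c ∈ algebraicClasses A.X p := by
  refine ⟨fun h A ↦ ⟨(h A).1, fun p _ _ c hc hpp ↦ (h A).2 p c hc hpp⟩, fun h A ↦ ⟨(h A).1, ?_⟩⟩
  intro p c hc hpp
  by_cases hmid : 1 ≤ p ∧ p < A.dim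
  · exact (h A).2 p hmid.1 hmid.2 c hc hpp
  · exact mem_algebraicClasses_of_dim_le A (by omega) c

/-- **Granting Lefschetz `(1,1)` and hard Lefschetz (named facts of the tree), the crux reduces to the
DEEP middle `2 ≤ p`, `2p ≤ dim A`; in particular a minimal counterexample has `dim A ≥ 4`.**
`p = 1` is `lefschetzOneOne_rational`; `2p > dim A` is reduced to codimension `dim A - p < p` by
`mem_algebraicClasses_of_lt_of_nonempty` (`L^{2p-n}` is a rational isomorphism of type `(2p-n, 2p-n)`
preserving algebraicity), and the strong induction on `p` closes. [cite: VoisinHodgeI2002, Thm. 6.25, Rem. 6.27, Thm. 11.30]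
[cite: KerrPearlstein2011, §3.1] -/
theorem hodgeAbelianVarieties_iff_deepMiddle
    (hM : ∀ (n : ℕ) (X : SchemeOver ℂ), nonempty_hodgeModel n X)
    (h11 : lefschetzOneOne_rational)
    (hHL : ∀ (n : ℕ) (X : SchemeOver ℂ), nonempty_hardLefschetzNFold n X) :
    HodgeAbelianVarieties ↔
      ∀ (A : AbelianVariety ℂ) (p : ℕ), 2 ≤ p → 2 * p ≤ A.dim →
        ∀ c : singularCohomology ℂ ℂ (ComplexPoints A.X) (2 * p), IsRationalClass c →
          IsOfHodgeType A.dim A.X (2 * p) p p c → c ∈ algebraicClasses A.X p := by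
  rw [iff_cyclePart hM]
  refine ⟨fun h A p _ _ c hc hpp ↦ h A p c hc hpp, fun h A ↦ ?_⟩
  have hX : IsSmoothProjective A.dim A.X := AbelianVariety.isSmoothProjective_holds
  -- strong induction on the codimension
  intro p
  induction p using Nat.strong_induction_on with
  | _ p ih =>
    intro c hc hpp
    by_cases h0 : p = 0 ∨ A.dim ≤ p
    · exact mem_algebraicClasses_of_dim_le A h0 c
    push Not at h0
    obtain ⟨hp0, hpd⟩ := h0
    by_cases h1 : p = 1
    · subst h1
      exact h11 hX c hc hpp
    by_cases hdeep : 2 * p ≤ A.dim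
    · exact h A p (by omega) hdeep c hc hpp
    · -- `dim A < 2p`: hard Lefschetz reduces to codimension `dim A - p < p`
      refine mem_algebraicClasses_of_lt_of_nonempty (hHL _ _) hX (by omega) ?_ c hc hpp
      intro c' hc' hpp'
      exact ih (A.dim - p) (by omega) c' hc' hpp'

/-- **`dim A ≤ 3` is settled from the tree's facts** (curves, surfaces, threefolds: Lefschetz `(1,1)`
and `L : H² ≅ H⁴`; the grounder's partial reduction, restated with projectivity now PROVED).
[cite: VoisinHodgeII2003, §10.2.3 proof of Prop. 10.26] -/
theorem of_dim_le_three (h3 : hodgeClasses_algebraic_of_dim_le_three)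
    (hM : ∀ (n : ℕ) (X : SchemeOver ℂ), nonempty_hodgeModel n X)
    (A : AbelianVariety ℂ) (hd : A.dim ≤ 3) : HodgeConjectureFor A.dim A.X :=
  hodgeConjectureFor_of_dim_le_three h3 (hM _ _) hd AbelianVariety.isSmoothProjective_holds

/-- **Dimension 4, the Weil plane** (tree fact `Markman2025_weilClasses_algebraic_abelianFourfold`,
Markman arXiv:2509.23403 Thm. 1.2 / arXiv:2502.03415 Cor. 1.6.1): on an abelian fourfold with
`φ ≫ φ = -d`, rational `(2,2)`-classes in the Weil plane `E₊ ⊔ E₋` are algebraic — the instance of the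
crux that was "the first test" of every counterexample programme (Weil 1977, Kontsevich–Zharkov) is
now a theorem. (The full `dim ≤ 5` statement, Cor. 1.3, needs Moonen–Zarhin's classification and is
print-only.) [cite: Markman2025SurveySecant, Thm. 1.2 and Cor. 1.3] -/
theorem weilPlane_dim_four (hW : Markman2025_weilClasses_algebraic_abelianFourfold)
    {d : ℕ} (hd : 0 < d) (A : AbelianVariety ℂ) (φ : A ⟶ A) (hA : A.dim = 2 * 2)
    (hφ : φ ≫ φ = -(d • 𝟙 A)) (c : singularCohomology ℂ ℂ (ComplexPoints A.X) (2 * 2))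
    (hc : IsRationalClass c) (h22 : IsOfHodgeType (2 * 2) A.X (2 * 2) 2 2 c)
    (hw : c ∈ weilClassesOf A φ 2 d) : c ∈ algebraicClasses A.X 2 :=
  hW d hd A φ hA (hA ▸ AbelianVariety.isSmoothProjective_holds) hφ c hc h22 hw

end Summit.HodgeConjecture.HodgeConjecture.Theorems.HodgeAbelianVarieties.Negative

end
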